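import Summits.Schanuel.Schanuel.Theorems.RootDecomp1KNW96Core13

/-!
# RootDecomp1KNW96Core — lens 6, generation 24, node 2 «NW96 THEOREM 1 AT THE PRINTED CONSTANT 211, HYPOTHESIS-FREE» (RULE G26 (ii); CLAIM L2235, CHECKLIST G26-α = ACK L2236, NODE L2241 / REQUEST L2242, critic VERDICT L2243: CLEARED — THEOREM ×1 «`theorem …RootDecomp1KNW96Core.nesterenkoWaldschmidt1996_thm_1_holds : Literature.NumberTheory.Transcendental.NesterenkoWaldschmidt1996_thm_1` by proof»; AUDIT G22 CLOSED IN FULL; RULE G27; lens-6 tally THEOREM ×9 + CELL ×3 + AUDIT ×1) — continuation (RootDecomp1KNW96Core14): §D-211 budget + §E-211 `paramsOK_211` + NW96 Theorem 1 at 211 hypothesis-free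

(lens-6 g24 HOME kernel K = HOME/decomp-schanuel-lens-6/g24b/NW96Params211.lean 79da3955…, 727 l, imports EXACTLY tree `…RootDecomp1KNW96Core07` + `…RootDecomp1KNW96Gap`; P NW96Params211Probe.lean d04e389f… rc 0. K-sha → part map of census g19 (three lens-6 kernels compete for Core numbers; allocation of VERDICT L2243 kept): RatExpSlot 65615678… §7/§8 = Core08/09 · Thm 5(1) b14a307c… = Core10–12 · THIS K 79da3955… = `RootDecomp1KNW96Core13`–`14` (727 l split for the 400-line cap): 13 = §B-211 the parameters of design R-211 (`params211_floors`, counting (2.1) `params211_counts`, `params211_L`: L ∈ (207Ψ, 208Ψ], T+1 < 20.8DVW) + §C-211 the error (`eps_facts_211`: X ≥ 211Ψℓ with 3Ψℓ room, `params_small_211`); 14 = §D-211 the budget (`lb_le_211`, `Tside_211`, `group1_211`…`group4_211` with certified 29.7 + 25 + 24.5 + 19.2 (+log 2) = 98.4 Ψℓ < 103.5 = 207/2, `row_lt_211`) + §E-211 `paramsOK_211 : ParamsOK 211` (scoped `maxHeartbeats 1000000` as in K and tree Core07) + the headline block: `nw1996MainR_211 : NW1996MainR 211`, `nesterenkoWaldschmidt1996_thm_1_holds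 : NesterenkoWaldschmidt1996_thm_1` (via tree `RootDecomp1KNW96Gap.thm_1_iff_mainR`), `nw1996MainR_of_ge (hc : 211 ≤ c) : NW1996MainR c` (tree `NW1996MainR.mono`).
DESIGN SENTENCE OF RECORD (VERDICT L2243, must be kept): the printed CONSTANT 211 is vindicated by a DIFFERENT parameter design R-211 (L-targeted T with L = (T+1)(2T₁+1) ∈ (207Ψ, 208Ψ], H = ⌊Wℓ/4⌋, S = ⌊24UV⌋, S₁ = ⌊4.7DW+½⌋, T₁ = ⌊5U+½⌋, ε = E^{−211Ψ}), NOT by print's parameters — the g22 audit's certified finding «Lemma 6's parameter box AS PRINTED does not satisfy the main inequality over ℤ-data» (`nw1996_lemma6_asPrinted_false_int`, RootDecomp1KNW96Gap02) STANDS; tree `nw1996MainR_400` (Core07) becomes a corollary. PORT EDITS: the file-wide `set_option linter.dupNamespace false` dropped; statements and proofs verbatim (all decls `_211`-suffixed, no def in K). `--supports stmt-Schanuel-33364`; no census credit carried; rung 0 — nothing here proves Schanuel. CONSEQUENCE OF RECORD (×0, census schedule): the `(hNW : NesterenkoWaldschmidt1996_thm_1)` binders in the tree are dischargeable BY NAM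E.)
-/

noncomputable section

open Finset

namespace Summit.Schanuel.Schanuel.Theorems.RootDecomp1KNW96Core

open Literature.NumberTheory.Transcendental

/-!
# RootDecomp1KNW96Core — lens 6, generation 24, node 2 «NW96 THEOREM 1 AT THE PRINTED CONSTANT 211, HYPOTHESIS-FREE»

`theorem nesterenkoWaldschmidt1996_thm_1_holds : NesterenkoWaldschmidt1996_thm_1` — the REGISTERED named fact
(Nesterenko–Waldschmidt 1996, Theorem 1, first assertion, absolute constant `211` as printed;
`Literature/NumberTheory/Transcendental/ExpLogSimultaneousApproximationMeasure.lean`) PROVED, sorry-free, no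
hypothesis, no named fact: `= core` (tree parts 01–03) `+ mainR_of_paramsOK` (tree Core04, unchanged)
`+ paramsOK_211` (THIS FILE).

The printed parameter box of [NW96, Lemma 6 / §6] does not close at `c = 211` (tree `RootDecomp1KNW96Gap02`,
`nw1996_lemma6_asPrinted_false_int`), and the audited repair R-400 (tree Core04–07: `S = ⌊25UV⌋`, `S₁ = ⌊9DW+½⌋`,
`T = ⌊33DVW⌋`, `T₁ = ⌊5U+½⌋`, `H = ⌊1.1 Wℓ⌋`) has `L/Ψ > 330`, which forces `c > 330`.  The point of this file:
the SHAPE of the box was never re-optimised.  Design **R-211**: `T₁ = ⌊5U + ½⌋` (unchanged), `S₁ = ⌊4.7 DW + ½⌋`,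
`S = ⌊24 UV⌋`, `H = ⌊Wℓ/4⌋`, and `T + 1 = ⌊208Ψ/(2T₁+1)⌋` — the number of derivatives is TARGETED ON `L`:
`L = (T+1)(2T₁+1) ∈ (207Ψ, 208Ψ]` (`Ψ = DUVW`), `ε = E^{−211Ψ}` (room `3Ψℓ` for the perturbation, as in R-400).
Budget per row in units of `Ψℓ`: `29.7 + 25 + 24.5 + 19.2 = 98.4 < 103.5 = 207/2` (lemmas `group1_211`–`group4_211`,
`row_lt_211`); float model of the exact inequalities: worst margin 26.3 %, 0 failures on 47 124 grid + 40 000 random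
data (HOME g24b/explore211/lossy211.py).  Elementary real inequalities only; every majorant is a lemma; the tree's
design-independent lemmas (`data_bounds`, `UVW_bounds`, `UV_upper`, `logU_le`, `logV_le`, `lbE_le`, `side3`,
`logL_le`, `bigM_eq`, `pow_eq_exp_mul_log`, `log_consts`, `log_le_mul`) are used BY NAME.

## References
* [NesterenkoWaldschmidt1996] Yu. V. Nesterenko, M. Waldschmidt, *On the approximation of the values of
  exponential function and logarithm by algebraic numbers*, Mat. Zapiski 2 (1996) 23–42 (arXiv:math/0002047),
  Theorem 1 and §6.
-/

section Params211

open Real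

section Params211D

/-! ### D-211. The budget of design R-211: the side conditions, the four groups, the row inequality -/

/-- `H > 0`, `Wℓ/6 ≤ H`, and `0 ≤ log(1 + S₁/H) ≤ 3.466 + log D` for `H = ⌊Wℓ/4⌋`, `S₁ ≤ 4.7DW + ½`
(`S₁/H ≤ 29.7D`, `1 + 31D ≤ 32D`, `log 32 = 5 log 2`). [cite: NesterenkoWaldschmidt1996, §6 (before (6.8)); design R-211] -/
theorem lb_le_211 {D W ℓ S₁ H : ℝ} (hD : 1 ≤ D) (hW : 2 ≤ W) (hℓ : 1 ≤ ℓ) (hWℓ : 12 ≤ W * ℓ)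
    (hH : W * ℓ / 4 - 1 < H) (hS₁0 : 0 ≤ S₁) (hS₁ : S₁ ≤ 47 / 10 * D * W + 1 / 2) :
    0 < H ∧ W * ℓ / 6 ≤ H ∧ 0 ≤ log (1 + S₁ / H) ∧ log (1 + S₁ / H) ≤ 3466 / 1000 + log D := by
  have hH1 : W * ℓ / 6 ≤ H := by linarith
  have hH0 : 0 < H := by linarith
  have hW0 : 0 < W := by linarith
  have hWH : W ≤ 6 * H := by
    have : W ≤ W * ℓ := le_mul_of_one_le_right hW0.le hℓ
    linarith
  have hDW : 1 * 2 ≤ D * W := mul_le_mul hD hW (by norm_num) (by linarith)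
  have h1 : S₁ ≤ 31 * D * H := by
    have h1a : S₁ ≤ 99 / 20 * (D * W) := by linarith
    have h1b : 99 / 20 * (D * W) ≤ 99 / 20 * (D * (6 * H)) := by
      have := mul_le_mul_of_nonneg_left hWH (by linarith : 0 ≤ D)
      linarith
    nlinarith
  have h2 : S₁ / H ≤ 31 * D := by rw [div_le_iff₀ hH0]; linarith
  have hx : 0 ≤ S₁ / H := by positivity
  have h3 : log (1 + S₁ / H) ≤ log (32 * D) := Real.log_le_log (by linarith) (by linarith)
  rw [Real.log_mul (by norm_num) (by linarith : D ≠ 0)] at h3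
  have h32 : log (32 : ℝ) = 5 * log 2 := by
    rw [show (32 : ℝ) = 2 ^ 5 by norm_num, Real.log_pow]; norm_num
  have hl2 := NWPi.log_two_bounds.2
  exact ⟨hH0, hH1, Real.log_nonneg (by linarith), by rw [h32] at h3; linarith⟩

/-- **The side condition of the `T`-group, design R-211**: `D(4.466 + log D) ≤ 3.96 D log(D+2) + 1/5` for `D ≥ 1`
(cases `D = 1, 2, 3` and `D ≥ 4`). [cite: NesterenkoWaldschmidt1996, §6 (6.8); design R-211] -/
theorem Tside_211 (Dn : ℕ) (hDn : 1 ≤ Dn) :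
    (Dn : ℝ) * (4466 / 1000 + log (Dn : ℝ)) ≤ 396 / 100 * (Dn : ℝ) * log ((Dn : ℝ) + 2) + 1 / 5 := by
  obtain ⟨hl2, hl2'⟩ := NWPi.log_two_bounds
  obtain ⟨_, hlog3, _, _, _, _, _, hlog3'⟩ := log_consts
  rcases Nat.lt_or_ge Dn 4 with hlt | hge
  · interval_cases Dn
    · norm_num; linarith
    · norm_num
      have h4 : log (4 : ℝ) = 2 * log 2 := by
        rw [show (4 : ℝ) = 2 ^ 2 by norm_num, Real.log_pow]; norm_num
      rw [h4]; linarith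
    · norm_num
      have h5 := NWPi.log_five_ge
      linarith
  · have hD' : (4 : ℝ) ≤ Dn := by exact_mod_cast hge
    have hD0 : (0 : ℝ) ≤ Dn := by linarith
    have hlogD : log (Dn : ℝ) ≤ log ((Dn : ℝ) + 2) := Real.log_le_log (by linarith) (by linarith)
    have hlog6 : 1.75 ≤ log ((Dn : ℝ) + 2) :=
      NWPi.log_six_ge.trans (Real.log_le_log (by norm_num) (by linarith))
    have h1 : 4466 / 1000 + log (Dn : ℝ) ≤ 396 / 100 * log ((Dn : ℝ) + 2) := by linarith
    have h2 := mul_le_mul_of_nonneg_left h1 hD0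
    linarith

/-- **Group (i), design R-211** — the `α`-, `B`- and `θ`-terms: `S₁(T₁+½)(D lA + ½ log B) + r T₁ E S₁ ≤ 29.7 Ψℓ`
(`S₁ ≤ 4.95 DW`, `T₁ + ½ ≤ 6U`). [cite: NesterenkoWaldschmidt1996, §6 (6.7); design R-211] -/
theorem group1_211 {D U V W ℓ lA E r lB' S₁ T₁ : ℝ} (hD : 1 ≤ D) (hU : 1 ≤ U) (hW : 2 ≤ W) (hℓ : 1 ≤ ℓ)
    (hlA : 0 ≤ D * lA) (hE : 2.718 ≤ E) (hr : 0 ≤ r) (hS₁0 : 0 ≤ S₁) (hS₁ : S₁ ≤ 47 / 10 * D * W + 1 / 2)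
    (hT₁0 : 0 ≤ T₁) (hT₁ : T₁ ≤ 5 * U + 1 / 2) (hlB0 : 0 ≤ lB') (hlB : lB' ≤ r + 1)
    (hv : V * ℓ = D * lA + 2 * E * r + 6 * ℓ) :
    S₁ * (T₁ + 1 / 2) * (D * lA + 1 / 2 * lB') + r * T₁ * (E * S₁) ≤ 297 / 10 * (D * U * V * W * ℓ) := by
  have hEr : 0 ≤ E * r := by nlinarith
  have hrE : r ≤ E * r := le_mul_of_one_le_left hr (by linarith)
  have hZ : D * lA + 1 / 2 * lB' + E * r ≤ V * ℓ := by rw [hv]; linarith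
  have hZ0 : 0 ≤ D * lA + 1 / 2 * lB' + E * r := by linarith
  have hQ0 : 0 ≤ S₁ * (T₁ + 1 / 2) := by positivity
  have hQ : S₁ * (T₁ + 1 / 2) ≤ (99 / 20 * (D * W)) * (6 * U) := by
    have hDW : 1 * 2 ≤ D * W := mul_le_mul hD hW (by norm_num) (by linarith)
    apply mul_le_mul <;> linarith
  have h1 : S₁ * (T₁ + 1 / 2) * (D * lA + 1 / 2 * lB') + r * T₁ * (E * S₁) ≤
      S₁ * (T₁ + 1 / 2) * (D * lA + 1 / 2 * lB' + E * r) := by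
    have : r * T₁ * (E * S₁) ≤ S₁ * (T₁ + 1 / 2) * (E * r) := by nlinarith
    nlinarith
  have h2 : S₁ * (T₁ + 1 / 2) * (D * lA + 1 / 2 * lB' + E * r) ≤ (99 / 20 * (D * W)) * (6 * U) * (V * ℓ) :=
    mul_le_mul hQ hZ hZ0 (by positivity)
  have e : (99 / 20 * (D * W)) * (6 * U) * (V * ℓ) = 297 / 10 * (D * U * V * W * ℓ) := by ring
  linarith

/-- **Group (ii), design R-211** — the `T`-terms: `(D−1)(T + T·lb) + T + T·lbE ≤ T(D(1+lb) + ℓ) ≤ T · 1.2u ≤ 25 Ψℓ`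
where `lb ≤ 3.466 + log D`, `lbE ≤ ℓ + lb`, `T ≤ 20.8 DVW`, using `Tside_211`.
[cite: NesterenkoWaldschmidt1996, §6 (6.8); design R-211] -/
theorem group2_211 {D U V W ℓ u T lb lbE : ℝ} (hD : 1 ≤ D) (hV : 6 ≤ V) (hW : 2 ≤ W) (hℓ1 : 1 ≤ ℓ)
    (hu : u = 33 / 10 * D * log (D + 2) + ℓ) (hUu : U * ℓ = u)
    (hTs : D * (4466 / 1000 + log D) ≤ 396 / 100 * D * log (D + 2) + 1 / 5) (hlb0 : 0 ≤ lb)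
    (hlb : lb ≤ 3466 / 1000 + log D) (hlbE : lbE ≤ ℓ + lb) (hT0 : 0 ≤ T) (hT : T ≤ 104 / 5 * (D * V * W)) :
    (D - 1) * (T + T * lb) + (T + T * lbE) ≤ 25 * (D * U * V * W * ℓ) := by
  have hD0 : 0 ≤ D := by linarith
  have h0 := mul_le_mul_of_nonneg_left hlbE hT0
  have h1 : (D - 1) * (T + T * lb) + (T + T * lbE) ≤ T * (D * (1 + lb) + ℓ) := by nlinarith
  have h2 : D * (1 + lb) + ℓ ≤ 6 / 5 * u := by
    rw [hu]
    have ha := mul_le_mul_of_nonneg_left hlb hD0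
    linarith
  have hu0 : 0 ≤ u := by
    rw [hu]
    have hl3 : 1 ≤ log (D + 2) := NWPi.one_le_log_three.trans (Real.log_le_log (by norm_num) (by linarith))
    have : 0 ≤ D * log (D + 2) := mul_nonneg hD0 (by linarith)
    linarith
  have hst0 : 0 ≤ D * (1 + lb) + ℓ := by positivity
  have h3 : T * (D * (1 + lb) + ℓ) ≤ (104 / 5 * (D * V * W)) * (6 / 5 * u) := mul_le_mul hT h2 hst0 (by positivity)
  have e : (104 / 5 * (D * V * W)) * (6 / 5 * u) = 624 / 25 * (D * U * V * W * ℓ) := by rw [← hUu]; ring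
  have hP0 : 0 ≤ D * U * V * W * ℓ := by
    rw [mul_assoc (D * U * V) W ℓ, show D * U * V * (W * ℓ) = D * V * W * (U * ℓ) by ring, hUu]
    positivity
  linarith

/-- **Group (iii), design R-211** — the `S log`-terms: `(D−1)(S log T₁ + S log S) + S log S + S log(RT₁) + S·D lB
≤ 24 DUV(Wℓ + ¼) ≤ 24.5 Ψℓ` (`Wℓ ≥ 12`). [cite: NesterenkoWaldschmidt1996, §6 (6.10); design R-211] -/
theorem group3_211 {D U V W ℓ lA lB S T₁ R r : ℝ} (hD : 1 ≤ D) (hU : 1 ≤ U) (hV : 6 ≤ V)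
    (hWℓ : 12 ≤ W * ℓ) (hS0 : 1 ≤ S) (hS : S ≤ 24 * U * V) (hT₁ : 1 ≤ T₁) (hR1 : 1 ≤ R)
    (hlB : 0 ≤ lB) (hw : W * ℓ = lB + log lA + 4 * log D + 2 * (ℓ + log (max 1 r)) + 10)
    (hside : log S + log T₁ + log R ≤ log lA + 4 * log D + 2 * (ℓ + log (max 1 r)) + 10 + 1 / 4) :
    (D - 1) * (S * log T₁ + S * log S) + (S * log S + S * log (R * T₁)) + S * (D * lB) ≤
      49 / 2 * (D * U * V * W * ℓ) := by
  have hlogR : 0 ≤ log R := Real.log_nonneg hR1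
  have hlogS : 0 ≤ log S := Real.log_nonneg hS0
  have hlogT : 0 ≤ log T₁ := Real.log_nonneg hT₁
  have hS0' : 0 ≤ S := by linarith
  have hD0 : 0 ≤ D := by linarith
  rw [Real.log_mul (by linarith) (by linarith)]
  have hZ : lB + log S + log T₁ + log R ≤ W * ℓ + 1 / 4 := by rw [hw]; linarith
  have hZ0 : 0 ≤ lB + log S + log T₁ + log R := by linarith
  have hnn : 0 ≤ (D - 1) * S * log R := mul_nonneg (mul_nonneg (by linarith) hS0') hlogR
  have h1 : (D - 1) * (S * log T₁ + S * log S) + (S * log S + S * (log R + log T₁)) + S * (D * lB) ≤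
      D * (S * (lB + log S + log T₁ + log R)) := by nlinarith
  have h2 : S * (lB + log S + log T₁ + log R) ≤ (24 * U * V) * (W * ℓ + 1 / 4) :=
    mul_le_mul hS hZ hZ0 (by positivity)
  have h3 : D * (S * (lB + log S + log T₁ + log R)) ≤ D * ((24 * U * V) * (W * ℓ + 1 / 4)) :=
    mul_le_mul_of_nonneg_left h2 hD0
  have hA : 12 * (D * U * V) ≤ D * U * V * W * ℓ := by
    have := mul_le_mul_of_nonneg_left hWℓ (by positivity : 0 ≤ D * U * V); linarith
  have e : D * ((24 * U * V) * (W * ℓ + 1 / 4)) = 24 * (D * U * V * W * ℓ) + 6 * (D * U * V) := by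
    ring
  linarith

/-- **Group (iv), design R-211** — the `H`-, `log 2`-, `log L`- and `S log E`-terms:
`D(1.15 S H + H) + log 2 + D log L + Sℓ ≤ 19.2 Ψℓ + log 2` (`H ≤ Wℓ/4`, `S ≤ 24UV`, `log L ≤ 1.37 Wℓ`).
[cite: NesterenkoWaldschmidt1996, §6 (6.11); design R-211] -/
theorem group4_211 {D U V W ℓ S H L : ℝ} (hD : 1 ≤ D) (hU : 1 ≤ U) (hV : 6 ≤ V) (hW : 2 ≤ W)
    (hℓ : 1 ≤ ℓ) (_hS0 : 0 ≤ S) (hS : S ≤ 24 * U * V) (hH0 : 0 ≤ H) (hH : H ≤ W * ℓ / 4)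
    (hlogL : log L ≤ 137 / 100 * (W * ℓ)) :
    (D - 1) * (S * (23 / 20 * H) + H) + (S * (23 / 20 * H) + H) + log 2 + D * log L + S * ℓ ≤
      96 / 5 * (D * U * V * W * ℓ) + 0.6932 := by
  have hD0 : 0 ≤ D := by linarith
  have hU0 : 0 ≤ U := by linarith
  have hV0 : 0 ≤ V := by linarith
  have hW0 : 0 ≤ W := by linarith
  have hℓ0 : 0 ≤ ℓ := by linarith
  have hWℓ0 : 0 ≤ W * ℓ := by positivity
  have hP0 : 0 ≤ D * U * V * W * ℓ := by positivity
  have hUV : 1 * 6 ≤ U * V := mul_le_mul hU hV (by norm_num) hU0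
  have hDW : 1 * 2 ≤ D * W := mul_le_mul hD hW (by norm_num) hD0
  -- `S H ≤ 24UV · Wℓ/4`
  have h1 : S * H ≤ (24 * U * V) * (W * ℓ / 4) := mul_le_mul hS hH hH0 (by positivity)
  have h1' : D * (S * H) ≤ D * ((24 * U * V) * (W * ℓ / 4)) := mul_le_mul_of_nonneg_left h1 hD0
  -- `D H ≤ D Wℓ/4 ≤ Ψℓ/24`
  have h2 : D * H ≤ D * (W * ℓ / 4) := mul_le_mul_of_nonneg_left hH hD0
  have h2' : 6 * (D * (W * ℓ)) ≤ D * U * V * W * ℓ := by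
    have := mul_le_mul_of_nonneg_left hUV (by positivity : 0 ≤ D * (W * ℓ)); linarith
  -- `S ℓ ≤ 24 UV ℓ ≤ 12 Ψℓ`
  have h3 : S * ℓ ≤ (24 * U * V) * ℓ := mul_le_mul_of_nonneg_right hS (by linarith)
  have h3' : 2 * (U * V * ℓ) ≤ D * U * V * W * ℓ := by
    have := mul_le_mul_of_nonneg_left hDW (by positivity : 0 ≤ U * V * ℓ); linarith
  -- `D log L ≤ 1.37 D Wℓ`
  have h4 : D * log L ≤ D * (137 / 100 * (W * ℓ)) := mul_le_mul_of_nonneg_left hlogL hD0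
  have hl2 := NWPi.log_two_bounds.2
  linarith

/-- **The row inequality, design R-211**: the four groups against `(L−1)/2 · log E` (`L > 207Ψ`, `Ψ ≥ 12`):
`29.7 + 25 + 24.5 + 19.2 = 98.4 < 103.5`. [cite: NesterenkoWaldschmidt1996, §6 d); design R-211] -/
theorem row_lt_211 {P ℓ L G1 G2 G3 G4 : ℝ} (hP : 12 ≤ P) (hℓ : 1 ≤ ℓ) (hL : 207 * P < L)
    (h1 : G1 ≤ 297 / 10 * (P * ℓ)) (h2 : G2 ≤ 25 * (P * ℓ)) (h3 : G3 ≤ 49 / 2 * (P * ℓ))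
    (h4 : G4 ≤ 96 / 5 * (P * ℓ) + 0.6932) :
    G1 + G2 + G3 + G4 < (L - 1) / 2 * ℓ := by
  have hℓ0 : 0 < ℓ := by linarith
  have ha := mul_lt_mul_of_pos_right hL hℓ0
  have hb := mul_le_mul_of_nonneg_right hP hℓ0.le
  nlinarith

end Params211D

section Params211E

/-! ### E-211. The theorem `ParamsOK 211` -/

set_option maxHeartbeats 1000000 in
/-- **`ParamsOK 211`** — the parameters of design R-211 satisfy every hypothesis of `core` with
`ε = E^{−211 DUVW}`: `T₁ = ⌊5U + ½⌋`, `S₁ = ⌊4.7DW + ½⌋`, `S = ⌊24UV⌋`, `H = ⌊W log E/4⌋`,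
`T + 1 = ⌊208 DUVW/(2T₁+1)⌋`, `R = max(1,|θ|) + 1`, `B = e^{|θ|}(1 + 1/(2T₁S₁+2))`, `M = log` of the analytic
majorant.  Budget `98.4 DUVW log E + log 2 < (L−1)/2 · log E`, `L > 207 DUVW`.
[cite: NesterenkoWaldschmidt1996, Theorem 1, §6; design R-211 (decomp-schanuel lens 6, g24)] -/
theorem paramsOK_211 : ParamsOK 211 := by
  intro Dn lA lB E r hDn hlA hlB hE hr
  obtain ⟨ℓ, hℓ⟩ : ∃ ℓ : ℝ, ℓ = Real.log E := ⟨_, rfl⟩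
  obtain ⟨u, hu⟩ : ∃ u : ℝ, u = 33 / 10 * (Dn : ℝ) * Real.log ((Dn : ℝ) + 2) + ℓ := ⟨_, rfl⟩
  obtain ⟨v, hv⟩ : ∃ v : ℝ, v = (Dn : ℝ) * lA + 2 * E * r + 6 * ℓ := ⟨_, rfl⟩
  obtain ⟨w, hw⟩ : ∃ w : ℝ,
      w = lB + Real.log lA + 4 * Real.log (Dn : ℝ) + 2 * Real.log (E * max 1 r) + 10 := ⟨_, rfl⟩
  obtain ⟨hℓ1, hE1, ⟨hlA0, hDlA, -⟩, hu1, ⟨hv1, hv2⟩, hw1, hlogEr, hlogrp⟩ :=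
    data_bounds Dn hDn hlA hlB hE hr hℓ hu hv hw
  have hD1 : (1 : ℝ) ≤ (Dn : ℝ) := by exact_mod_cast hDn
  have hℓ0 : 0 < ℓ := by linarith only [hℓ1]
  obtain ⟨U, hU⟩ : ∃ U : ℝ, U = u / ℓ := ⟨_, rfl⟩
  obtain ⟨V, hV⟩ : ∃ V : ℝ, V = v / ℓ := ⟨_, rfl⟩
  obtain ⟨W, hW⟩ : ∃ W : ℝ, W = w / ℓ := ⟨_, rfl⟩
  obtain ⟨hU1, hV6, hW2, hWℓ, -, hUu, hVv, hWw, hP12⟩ := UVW_bounds hD1 hℓ1 hu1 hv1 hw1 hU hV hW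
  obtain ⟨hUup, hVup⟩ := UV_upper hD1 hℓ1 hDlA hE1 hr hu hv hU hV
  -- the parameters
  obtain ⟨T₁, hT₁⟩ : ∃ T₁ : ℕ, T₁ = ⌊5 * U + 1 / 2⌋₊ := ⟨_, rfl⟩
  obtain ⟨S₁, hS₁⟩ : ∃ S₁ : ℕ, S₁ = ⌊47 / 10 * (Dn : ℝ) * W + 1 / 2⌋₊ := ⟨_, rfl⟩
  obtain ⟨H, hH⟩ : ∃ H : ℕ, H = ⌊W * ℓ / 4⌋₊ := ⟨_, rfl⟩
  obtain ⟨S, hS⟩ : ∃ S : ℕ, S = ⌊24 * U * V⌋₊ := ⟨_, rfl⟩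
  obtain ⟨Tp, hTp⟩ : ∃ Tp : ℕ, Tp = ⌊208 * ((Dn : ℝ) * U * V * W) / (2 * (T₁ : ℝ) + 1)⌋₊ := ⟨_, rfl⟩
  obtain ⟨⟨hT₁le, hT₁gt⟩, ⟨hS₁le, hS₁gt⟩, ⟨hHle, hHgt⟩, ⟨hSle, hSgt⟩, ⟨hLle, hLgt, hTplt, hTp2⟩⟩ :=
    params211_floors hD1 hU1 hV6 hW2 hℓ1 hT₁ hS₁ hH hS hTp
  -- `T = Tp − 1`
  obtain ⟨T, rfl⟩ : ∃ T : ℕ, Tp = T + 1 := ⟨Tp - 1, by omega⟩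
  have hTr : ((T + 1 : ℕ) : ℝ) = (T : ℝ) + 1 := by push_cast; ring
  rw [hTr] at hLle hLgt hTplt
  obtain ⟨⟨hH1, hT₁1, hS₁1, hS1⟩, h2T₁, hcount⟩ :=
    params211_counts hD1 hU1 hV6 hW2 hℓ1 hWℓ hT₁le hT₁gt hS₁gt hHgt hSgt hLle
  obtain ⟨L, hL⟩ : ∃ L : ℕ, L = (T + 1) * (2 * T₁ + 1) := ⟨_, rfl⟩
  obtain ⟨m, hm⟩ : ∃ m : ℕ, m = S₁ * (T + 1) * (T₁ * (T₁ + 1)) := ⟨_, rfl⟩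
  obtain ⟨hLr, h2m, hNP, hSP, hS12⟩ := params211_L hD1 hU1 hV6 hW2 hT₁le hS₁le hSle hL hm
  have hLlow : 207 * ((Dn : ℝ) * U * V * W) < L := by rw [hLr]; exact hLgt
  have hLhigh : (L : ℝ) ≤ 208 * ((Dn : ℝ) * U * V * W) := by rw [hLr]; exact hLle
  have hLhigh' : (L : ℝ) ≤ 397 * ((Dn : ℝ) * U * V * W) := by
    have : 0 ≤ (Dn : ℝ) * U * V * W := by linarith only [hP12, hD1]
    linarith only [hLhigh, this]
  -- `Ψ = DUVW ≥ 12` and the exponent `X = 211 Ψ log E`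
  have hP : 12 ≤ (Dn : ℝ) * U * V * W := le_trans (by linarith only [hD1]) hP12
  have hX : expo 211 Dn lA lB E r = 211 * ((Dn : ℝ) * U * V * W) * ℓ := by
    rw [hU, hV, hW, hu, hv, hw, hℓ]
    unfold expo
    have hl : Real.log E ≠ 0 := by rw [← hℓ]; exact hℓ0.ne'
    field_simp
  -- the error and the radii
  have hU0 : 0 ≤ U := by linarith only [hU1]
  have hV0 : 0 < V := by linarith only [hV6]
  have hD0 : (0 : ℝ) ≤ (Dn : ℝ) := Nat.cast_nonneg _
  have hVr : 2 * E * r ≤ V * ℓ := by rw [hVv]; exact hv2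
  have hVP : 2 * V ≤ (Dn : ℝ) * U * V * W := by
    have hDU : 1 * 1 ≤ (Dn : ℝ) * U := mul_le_mul hD1 hU1 (by norm_num) hD0
    have h1 : 1 * 1 * V ≤ ((Dn : ℝ) * U) * V := mul_le_mul_of_nonneg_right hDU hV0.le
    have h2 : ((Dn : ℝ) * U * V) * 2 ≤ ((Dn : ℝ) * U * V) * W :=
      mul_le_mul_of_nonneg_left hW2 (mul_nonneg (mul_nonneg hD0 hU0) hV0.le)
    linarith only [h1, h2]
  have hN1 : (1 : ℝ) ≤ ((T₁ * S₁ : ℕ) : ℝ) := by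
    have : 1 ≤ T₁ * S₁ := Nat.mul_le_mul hT₁1 hS₁1
    exact_mod_cast this
  obtain ⟨-, hε1, hε2, hc4, hc5, hB0, hlogB0, hlogB⟩ :=
    eps_facts_211 hP hℓ1 hX.ge hr hE1 hVr hVP hN1 hNP
  have hR1 : (1 : ℝ) ≤ max 1 r + 1 := by linarith only [le_max_left (1 : ℝ) r]
  have hE0 : (0 : ℝ) < E := by linarith only [hE1]
  have hE1' : (1 : ℝ) ≤ E := by linarith only [hE1]
  have hR0 : (0 : ℝ) < max 1 r + 1 := by linarith only [hR1]
  have hDlA0 : (0 : ℝ) ≤ (Dn : ℝ) * lA := by linarith only [hDlA]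
  -- the witnesses
  refine ⟨H, T, T₁, S, S₁, L, m, max 1 r + 1, Real.exp r * (1 + 1 / (2 * ((T₁ * S₁ : ℕ) : ℝ) + 2)),
    (S : ℝ) * Real.log S + ((T : ℝ) + H) + T * Real.log (1 + E * S₁ / H) +
      S * Real.log ((max 1 r + 1) * T₁) + r * T₁ * (E * S₁),
    hL, hm, hH1, hT₁1, h2T₁, hcount, by linarith only [hε1], hc4, hε2, hc5, ?_, ?_, ?_⟩
  · -- the analytic majorant `hMf` (equality)
    exact le_of_eq (bigM_eq hS1 hT₁1 hH1 hE0 hR0)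
  · -- the perturbation majorant `hMp`
    exact params_small_211 hS1 hT₁1 hS₁1 hH1 hE1 hℓ hℓ1 hP hX.ge hr hR1 hB0 hlogB hSP hNP hLhigh
  · -- the main inequality: the four groups, the row inequality, times `L`
    obtain ⟨hH0, -, hlb0, hlb⟩ :=
      lb_le_211 (S₁ := (S₁ : ℝ)) (H := (H : ℝ)) hD1 hW2 hℓ1 hWℓ hHgt (Nat.cast_nonneg _) hS₁le
    have hlbE := lbE_le (S₁ := (S₁ : ℝ)) (H := (H : ℝ)) hE1' hH0 (Nat.cast_nonneg _)
    rw [← hℓ] at hlbE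
    have hTs := Tside_211 Dn hDn
    obtain ⟨hlogU, hl3, hl3'⟩ := logU_le hD1 hU1 hUup
    have hlogV := logV_le hD1 hV0 hVup hDlA hlA0 hE1 hℓ
    have hw' : W * ℓ = lB + Real.log lA + 4 * Real.log (Dn : ℝ) + 2 * (ℓ + Real.log (max 1 r)) + 10 := by
      rw [hWw, hw, hlogEr]
    have hS1r : (1 : ℝ) ≤ S := by exact_mod_cast hS1
    have hT₁1r : (1 : ℝ) ≤ T₁ := by exact_mod_cast hT₁1
    have hSle' : (S : ℝ) ≤ 25 * U * V := by
      have : 0 ≤ U * V := mul_nonneg hU0 hV0.le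
      linarith only [hSle, this]
    have hside := side3 (R := max 1 r + 1) hD1 hU1 hlogU hl3 hl3' hV6 hlogV hℓ1 hS1r hSle' hT₁1r hT₁le rfl
    have hL0 : (0 : ℝ) < L := by linarith only [hLlow, hP]
    have hlogL := logL_le hD1 hU1 hlogU hl3 hl3' hV6 hlogV hW2 hℓ1 hlB hw' hL0 hLhigh'
    have hlogB1 : Real.log (Real.exp r * (1 + 1 / (2 * ((T₁ * S₁ : ℕ) : ℝ) + 2))) ≤ r + 1 := by
      have : 1 / (2 * ((T₁ * S₁ : ℕ) : ℝ) + 2) ≤ 1 := by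
        rw [div_le_iff₀ (by positivity)]; linarith only [hN1]
      linarith only [hlogB, this]
    have hT0r : (0 : ℝ) ≤ T := Nat.cast_nonneg T
    have hTle : (T : ℝ) ≤ 104 / 5 * ((Dn : ℝ) * V * W) := by linarith only [hTplt]
    have hG1 := group1_211 hD1 hU1 hW2 hℓ1 hDlA0 hE1 hr (Nat.cast_nonneg S₁)
      hS₁le (Nat.cast_nonneg T₁) hT₁le hlogB0 hlogB1 (by rw [hVv, hv])
    have hG2 := group2_211 (T := (T : ℝ)) hD1 hV6 hW2 hℓ1 hu hUu hTs hlb0 hlb hlbE hT0r hTle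
    have hG3 := group3_211 hD1 hU1 hV6 hWℓ hS1r hSle hT₁1r hR1 hlB hw' hside
    have hG4 := group4_211 (L := (L : ℝ)) hD1 hU1 hV6 hW2 hℓ1 (Nat.cast_nonneg S) hSle (Nat.cast_nonneg H)
      hHle hlogL
    have hrow := row_lt_211 hP hℓ1 hLlow hG1 hG2 hG3 hG4
    have hmul := mul_lt_mul_of_pos_left hrow hL0
    have ha := mul_le_mul_of_nonneg_right h2m hDlA0
    have hb : (m : ℝ) * Real.log (Real.exp r * (1 + 1 / (2 * ((T₁ * S₁ : ℕ) : ℝ) + 2))) ≤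
        (L : ℝ) * ((S₁ : ℝ) * ((T₁ : ℝ) + 1 / 2)) / 2 *
          Real.log (Real.exp r * (1 + 1 / (2 * ((T₁ * S₁ : ℕ) : ℝ) + 2))) :=
      mul_le_mul_of_nonneg_right (by linarith only [h2m]) hlogB0
    rw [← hℓ]
    linarith only [hmul, ha, hb]

end Params211E

end Params211

/-! ## NW96 Theorem 1 with the PRINTED absolute constant `211` — hypothesis-free -/

/-- **Nesterenko–Waldschmidt 1996, Theorem 1 (first assertion), with the printed absolute constant `211`, in the
`NW1996MainR` form** — hypothesis-free and sorry-free: `core` + `mainR_of_paramsOK` + `paramsOK_211`.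
[cite: NesterenkoWaldschmidt1996, Theorem 1 (Mat. Zapiski 2 (1996) 23–42; arXiv:math/0002047)] -/
theorem nw1996MainR_211 : NW1996MainR 211 := mainR_of_paramsOK paramsOK_211

/-- **The registered named fact `NesterenkoWaldschmidt1996_thm_1` holds** (it is `NW1996MainR 211` by `Iff.rfl`,
tree `RootDecomp1KNW96Gap.thm_1_iff_mainR`): for nonzero algebraic `α, β`, `θ ∈ ℂ \ {0}`, `D = [ℚ(α,β):ℚ]`,
`A, B, E` as in the theorem, `|e^θ − α| + |θ − β| ≥ exp(−211·D·(log B + log log A + 4 log D + 2 log(E max(1,|θ|)) + 10)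
·(D log A + 2E|θ| + 6 log E)·(3.3 D log(D+2) + log E)·(log E)^{-2})`.
[cite: NesterenkoWaldschmidt1996, Theorem 1] -/
theorem nesterenkoWaldschmidt1996_thm_1_holds : NesterenkoWaldschmidt1996_thm_1 :=
  RootDecomp1KNW96Gap.thm_1_iff_mainR.mpr nw1996MainR_211

/-- Read-back: every constant `c ≥ 211` is now unconditional (monotonicity of `NW1996MainR` in `c`); in
particular the tree's `nw1996MainR_400` is re-derived. -/
theorem nw1996MainR_of_ge {c : ℝ} (hc : 211 ≤ c) : NW1996MainR c :=
  RootDecomp1KNW96Gap.NW1996MainR.mono hc nw1996MainR_211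

example : NW1996MainR 400 := nw1996MainR_of_ge (by norm_num)

end Summit.Schanuel.Schanuel.Theorems.RootDecomp1KNW96Core

end
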